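import Mathlib
import HarnessLib
import Summits.ValiantsHypothesis.ValiantsHypothesis.Theses.MonotoneRestoration
import Literature.Computability.AlgebraicComplexity.ArithCircuit
import Literature.Computability.AlgebraicComplexity.ArithCircuitProofs
import Literature.Computability.AlgebraicComplexity.MonotoneStructure
import Literature.Computability.AlgebraicComplexity.PermanentIrreducible
import Literature.ModelTheory.FiniteModelTheory.CkEquiv
import Summits.ValiantsHypothesis.ValiantsHypothesis.Theorems.MonotoneRestorationMonotoneRestorationQPCosetCount
import Summits.ValiantsHypothesis.ValiantsHypothesis.Theorems.MonotoneRestorationMonotoneRestorationQPSymmetricLB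
import Summits.ValiantsHypothesis.ValiantsHypothesis.Theorems.MonotoneRestorationMonotoneRestorationQPSupportSymmetrisation
import Summits.ValiantsHypothesis.ValiantsHypothesis.Theorems.MonotoneRestorationMonotoneRestorationQPSparseRegime
import Summits.ValiantsHypothesis.ValiantsHypothesis.Theorems.MonotoneRestorationMonotoneRestorationQPBeta
import Literature.Computability.AlgebraicComplexity.SymmetricArithCircuit
import Literature.Computability.AlgebraicComplexity.DawarWilsenach2025Proofs
import Literature.GroupTheory.PermutationGroups.SmallIndexSubgroups
import Summits.ValiantsHypothesis.ValiantsHypothesis.Theorems.MonotoneRestorationQP.Negative.LoadBearing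
import Summits.ValiantsHypothesis.ValiantsHypothesis.Theorems.MonotoneRestorationMonotoneRestorationQPPermSupportCount

/-! TTRL-lite variant V18958 of stmt-ValiantsHypothesis-15886 -/

-- `Summit.ValiantsHypothesis.ValiantsHypothesis.…` is the tree's mandated single-conjunct layout
-- (Sub = Summit), so the duplicated namespace component is intended.
set_option linter.dupNamespace false

namespace Summit.ValiantsHypothesis.ValiantsHypothesis.Theorems

open Summit.ValiantsHypothesis.ValiantsHypothesis.Theses.MonotoneRestoration
open Literature.Computability.AlgebraicComplexity

/-- **TTRL-lite variant V18958** (`generalise`: the converse / ascent direction of the circuit-free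
kernel of `stub_mulGate_children_extend`, item `stmt-ValiantsHypothesis-15886`) is FALSE: support
extension into `f` passes DOWN from a product to its factors, never up. Witness `n = 1`,
`p = q = f = X (0,0)` over `ℝ≥0`: both factors extend into `f` with the zero shift, but the unique
monomial of `p * q = X (0,0) ^ 2` is `Finsupp.single (0,0) 2`, and `Finsupp.single (0,0) 2 + μ`
has exponent `2 + μ (0,0) ≠ 1` at `(0,0)`, so it is never the unique monomial
`Finsupp.single (0,0) 1` of `f`.  This is why the spine argument of the line runs top-down.
[folklore] -/
theorem stub_mulGate_children_extend_var18958_false :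
    ¬ (∀ (n : ℕ) (p q f : MvPolynomial (Fin n × Fin n) NNReal), p ≠ 0 → q ≠ 0 →
        (∃ μ : (Fin n × Fin n) →₀ ℕ, ∀ m ∈ p.support, m + μ ∈ f.support) →
        (∃ μ : (Fin n × Fin n) →₀ ℕ, ∀ m ∈ q.support, m + μ ∈ f.support) →
        ∃ μ : (Fin n × Fin n) →₀ ℕ, ∀ m ∈ (p * q).support, m + μ ∈ f.support) := by
  intro h
  set x : MvPolynomial (Fin 1 × Fin 1) NNReal := MvPolynomial.X ((0 : Fin 1), (0 : Fin 1)) with hx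
  have hx0 : x ≠ 0 := MvPolynomial.X_ne_zero _
  have hself : ∃ μ : (Fin 1 × Fin 1) →₀ ℕ, ∀ m ∈ x.support, m + μ ∈ x.support :=
    ⟨0, fun m hm => by rwa [add_zero]⟩
  obtain ⟨μ, hμ⟩ := h 1 x x x hx0 hx0 hself hself
  have hsuppx : x.support = {Finsupp.single ((0 : Fin 1), (0 : Fin 1)) 1} := by
    rw [hx, MvPolynomial.support_X]
  have hmul : (x * x).support = {Finsupp.single ((0 : Fin 1), (0 : Fin 1)) 2} := by
    have hx2 : x * x = MvPolynomial.monomial (Finsupp.single ((0 : Fin 1), (0 : Fin 1)) 2) 1 := by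
      rw [← sq, hx, MvPolynomial.X_pow_eq_monomial]
    rw [hx2, MvPolynomial.support_monomial, if_neg one_ne_zero]
  have h1 := hμ (Finsupp.single ((0 : Fin 1), (0 : Fin 1)) 2)
    (by rw [hmul]; exact Finset.mem_singleton_self _)
  rw [hsuppx, Finset.mem_singleton] at h1
  have h2 := congrArg (fun g : Fin 1 × Fin 1 →₀ ℕ => g ((0 : Fin 1), (0 : Fin 1))) h1
  simp only [Finsupp.coe_add, Pi.add_apply, Finsupp.single_eq_same] at h2
  omega

end Summit.ValiantsHypothesis.ValiantsHypothesis.Theorems
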